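import Summits.AtomisticToContinuum.HydrodynamicLimit.Theorems.JParityClosureLocalSecondLawLedgerHonestB
import Summits.AtomisticToContinuum.HydrodynamicLimit.Theorems.JParityClosureLocalSecondLawLedgerInner
import Summits.AtomisticToContinuum.HydrodynamicLimit.Theorems.JParityClosureLocalSecondLawLedgerObsCont
import Literature.Analysis.FluidPDE.CollisionalTransferTimeDep

/-!
# Entropy ledger for `JParityClosure.LocalSecondLaw` — the balance law along the regular orbit
(stmt-AtomisticToContinuum-13081, line `exact-entropy-ledger-three-passivities`, layer 13 of stub L)

On the regular event the modified observable IS the crux functional's boundary pairing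
(`Ĥ(U_r) = H(ρ_r, θ_r)` on the regular range), its streaming derivative is
`∫ φ ∂ₜS + ∫ H ∂ₛφ` (the free-flight derivative of `Ĥ ∘ U_r` and the chain-rule rate `∂ₜS` of layer 5 are
derivatives of the same function near a regular configuration), and the weak balance law of the Literature
(`IsHardSphereTrajectory.sub_eq_integral_add_finsum_collisionJump_td`) along the good orbit gives
`-bdry = ∫₀^τ (∫ φ ∂ₜS + ∫ H ∂ₛφ) ds + Σ_{collisions in (0,τ]} jumps`, and with the integrated Gibbs identity
(layer 6) and the honesty of the time integrals (layer 12),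
`∫₀^τ (∫ φ ∂ₜS + ∫ H ∂ₛφ) ds = entropyFunctional - T₁ - T₂smooth - T₃kin`.

References: H. Spohn, *Large Scale Dynamics of Interacting Particles* (1991), Part I §3.2;
S. R. de Groot, P. Mazur, *Non-Equilibrium Thermodynamics* (1962) Ch. II §2.
-/

noncomputable section

namespace Summit.AtomisticToContinuum.HydrodynamicLimit.Theorems.LocalSecondLawLedger

open scoped BigOperators Topology ENNReal InnerProductSpace NNReal
open Filter Set MeasureTheory
open Literature.MathematicalPhysics.KineticTheory
open Literature.Analysis.FluidPDE
open Literature.Analysis.FunctionSpaces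
open Summit.AtomisticToContinuum.HydrodynamicLimit.Theorems.LocalSecondLawNegative

namespace L

variable {N : ℕ}

/-- Torus translation is continuous (hypothesis of the Literature's trajectory lemmas). [folklore] -/
private theorem hG3 : ∀ x : T3, Continuous ((Torus.geometry (Fin 3)).translate x) := fun _ =>
  continuous_const.add Torus.continuous_proj

section RegularConfig

variable {σ r c η₁ η₀ : ℝ} {F : ℝ → ℝ} (hE : EosBand η₀ F) (hη : 0 < η₁) (hη₁ : η₁ < η₀) (hσ : 0 < σ)
  (hr : 0 < r) (hc : 0 < c) {w : Phase N}
  (hreg : ∀ x, c ≤ rhoC r w x ∧ rhoC r w x * σ ^ 3 ≤ η₁ ∧ c ≤ thetaC r w x)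

include hE hη₁ hσ hc hreg in
/-- At a good field point of a regular configuration, the entropy density along the free flight has
derivative `∂ₜS = dSfl`. [folklore] -/
theorem hasDerivAt_Hs_flight {x : T3}
    (hx : ∀ i, DifferentiableAt ℝ (Torus.liftAt (fun z : T3 => cone r z 0) ((w i).1 - x)) 0) :
    HasDerivAt (fun t : ℝ => Hs σ (rhoC r (freeFlight (Torus.geometry (Fin 3)) t w) x)
      (thetaC r (freeFlight (Torus.geometry (Fin 3)) t w) x)) (dSfl σ r w x) 0 := by
  have hρ := hasDerivAt_rhoC_flight hx
  have hm := fun l => hasDerivAt_momC_flight hx l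
  have he := hasDerivAt_kinC_flight hx
  have hρ0 : rhoC r (freeFlight (Torus.geometry (Fin 3)) 0 w) x ≠ 0 := by
    rw [freeFlight_zero]; exact (hc.trans_le (hreg x).1).ne'
  have hfun : (fun t : ℝ => thetaC r (freeFlight (Torus.geometry (Fin 3)) t w) x) = fun t =>
      2 / 3 * (kinC r (freeFlight (Torus.geometry (Fin 3)) t w) x / rhoC r (freeFlight (Torus.geometry (Fin 3)) t w) x
        - (∑ k, momC r (freeFlight (Torus.geometry (Fin 3)) t w) x k ^ 2)
          / (2 * rhoC r (freeFlight (Torus.geometry (Fin 3)) t w) x ^ 2)) := funext fun t => thetaC_eq r _ x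
  have hθ := hasDerivAt_theta_curve hρ hm he hρ0
  rw [← hfun] at hθ
  have hρ0' : 0 < rhoC r (freeFlight (Torus.geometry (Fin 3)) 0 w) x := by
    rw [freeFlight_zero]; exact hc.trans_le (hreg x).1
  have hθ0 : 0 < thetaC r (freeFlight (Torus.geometry (Fin 3)) 0 w) x := by
    rw [freeFlight_zero]; exact hc.trans_le (hreg x).2.2
  have hband : rhoC r (freeFlight (Torus.geometry (Fin 3)) 0 w) x * σ ^ 3 < η₀ := by
    rw [freeFlight_zero]; exact (hreg x).2.1.trans_lt hη₁
  have h := hasDerivAt_Hs hE hρ hθ hρ0' hθ0 hσ hband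
  simp only [freeFlight_zero] at h
  refine h.congr_deriv ?_
  unfold dSfl SD thetaD
  simp only [Fin.sum_univ_three]
  ring

include hE hη hη₁ hσ hc hreg in
/-- At a good field point of a regular configuration the free-flight chain-rule value of `Ĥ ∘ U_r` is `dSfl`
(both are derivatives at `0` of the same function, `Ĥ ∘ U_r = H(ρ_r, θ_r)` near a regular configuration).
[folklore] -/
theorem fderiv_Hhat_Udot_eq_dSfl {x : T3}
    (hx : ∀ i, DifferentiableAt ℝ (Torus.liftAt (fun z : T3 => cone r z 0) ((w i).1 - x)) 0) :
    fderiv ℝ (Hhat σ c η₀ η₁) (U r w x) (Udot r w x) = dSfl σ r w x := by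
  have hH := contDiff_Hhat hE hη hη₁ hσ hc
  have hU := hasDerivAt_U_flight hx (r := r) (w := w) (x := x)
  have hU0 : U r (freeFlight (Torus.geometry (Fin 3)) 0 w) x = U r w x := by rw [freeFlight_zero]
  have h1 : HasDerivAt (fun t : ℝ => Hhat σ c η₀ η₁ (U r (freeFlight (Torus.geometry (Fin 3)) t w) x))
      (fderiv ℝ (Hhat σ c η₀ η₁) (U r w x) (Udot r w x)) 0 := by
    have h := (hH.differentiable one_ne_zero (U r (freeFlight (Torus.geometry (Fin 3)) 0 w) x)).hasFDerivAt.comp_hasDerivAt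
      (0 : ℝ) hU
    rw [hU0] at h
    exact h
  -- near `t = 0` the conserved fields stay in the neighbourhood of the regular range
  have hmem : U r w x ∈ regNbhd σ c η₀ η₁ := by
    refine mem_regNbhd_of_regular hη₁ hc (hreg x).1 ?_ (hreg x).2.1
    show c ≤ thetaOf (rhoC r w x) (kinC r w x) (WithLp.ofLp (momC r w x))
    rw [thetaOf_U]; exact (hreg x).2.2
  have hev : ∀ᶠ t : ℝ in 𝓝 0, U r (freeFlight (Torus.geometry (Fin 3)) t w) x ∈ regNbhd σ c η₀ η₁ := by
    have hct : ContinuousAt (fun t : ℝ => U r (freeFlight (Torus.geometry (Fin 3)) t w) x) 0 := hU.continuousAt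
    rw [ContinuousAt, hU0] at hct
    exact hct.eventually ((isOpen_regNbhd hc).mem_nhds hmem)
  have hagree : (fun t : ℝ => Hhat σ c η₀ η₁ (U r (freeFlight (Torus.geometry (Fin 3)) t w) x)) =ᶠ[𝓝 0]
      fun t => Hs σ (rhoC r (freeFlight (Torus.geometry (Fin 3)) t w) x) (thetaC r (freeFlight (Torus.geometry (Fin 3)) t w) x) := by
    filter_upwards [hev] with t ht
    rw [Hhat_eq_Hsm hη₁ hc ht]
    show Hsm σ (rhoC r _ x) (thetaOf (rhoC r _ x) (kinC r _ x) (WithLp.ofLp (momC r _ x))) = _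
    have hθt : c / 2 < thetaOf (rhoC r (freeFlight (Torus.geometry (Fin 3)) t w) x) (kinC r _ x) (WithLp.ofLp (momC r _ x)) := ht.2.1
    rw [thetaOf_U] at hθt ⊢
    have hρt : c / 2 < rhoC r (freeFlight (Torus.geometry (Fin 3)) t w) x := ht.1
    exact (Hs_eq_Hsm (by linarith) (by linarith)).symm
  have h2 := hasDerivAt_Hs_flight hE hη₁ hσ hc hreg hx
  exact (h1.congr_of_eventuallyEq hagree.symm).unique h2

end RegularConfig

/-! ## The balance law along the regular orbit -/

section Balance

variable {σ r c η₁ η₀ τ : ℝ} {F : ℝ → ℝ} (hE : EosBand η₀ F) (hη : 0 < η₁) (hη₁ : η₁ < η₀) (hσ : 0 < σ)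
  (hr : 0 < r) (hc : 0 < c) (hτ : 0 < τ) {φ : ℝ → T3 → ℝ} (hφ : Torus.IsSmoothSpaceTimeOn Set.univ φ)
  (hsupp : ∃ τ' : ℝ, τ' < τ ∧ ∀ s, τ' ≤ s → ∀ x, φ s x = 0)
  (Φ : Flow σ N) {z : Phase N} (hR : Regular σ r τ c η₁ Φ z)

include hE hη hη₁ hσ hr hc hφ hR in
/-- **The streaming derivative on the regular orbit** is `∫ φ ∂ₜS + ∫ H ∂ₛφ`. [folklore] -/
theorem obsD_orbit_eq {s : ℝ} (hs : s ∈ Set.Icc 0 τ) :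
    obsD σ c η₀ η₁ r φ s (Φ.flow s z) = (∫ x, φ s x * dSfl σ r (Φ.flow s z) x)
      + ∫ x, Hs σ (rhoC r (Φ.flow s z) x) (thetaC r (Φ.flow s z) x) * deriv (fun s' => φ s' x) s := by
  have hreg := hR.2 s hs
  have hae : ∀ᵐ x : T3, obsDi σ c η₀ η₁ r φ s (Φ.flow s z) x = φ s x * dSfl σ r (Φ.flow s z) x
      + Hs σ (rhoC r (Φ.flow s z) x) (thetaC r (Φ.flow s z) x) * deriv (fun s' => φ s' x) s := by
    filter_upwards [ae_differentiableAt_cone hr (Φ.flow s z)] with x hx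
    unfold obsDi
    rw [← fderiv_Hhat_Udot σ c η₀ η₁ r (Φ.flow s z) x (U r (Φ.flow s z) x),
      fderiv_Hhat_Udot_eq_dSfl hE hη hη₁ hσ hc hreg hx, Hhat_U_eq_Hs hη₁ hc hreg]
    ring
  have hI1 : Integrable (fun x => φ s x * dSfl σ r (Φ.flow s z) x) :=
    (integral_mul_dSfl hE hη₁ hσ hr hc (Φ.flow s z) hreg (g := φ s)
      ((hφ.isSmooth_slice (Set.mem_univ s)).isContDiff (by simp))).1
  have hI2 : Integrable (fun x => Hs σ (rhoC r (Φ.flow s z) x) (thetaC r (Φ.flow s z) x) * deriv (fun s' => φ s' x) s) :=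
    integrable_of_continuous_T3 ((continuous_Hs_comp hE hη₁ hσ hr hc (Φ.flow s z) hreg).mul
      ((continuous_uncurry_deriv_of_smooth hφ).uncurry_left s))
  unfold obsD
  rw [integral_congr_ae hae, integral_add hI1 hI2]

include hE hη hη₁ hσ hr hc hφ hR in
/-- On the regular orbit the streaming derivative is the crux integrand minus the three smooth ledger
integrands. [folklore] -/
theorem obsD_orbit_eq_ledger {s : ℝ} (hs : s ∈ Set.Icc 0 τ) :
    obsD σ c η₀ η₁ r φ s (Φ.flow s z) =
      (∫ x, Hs σ (rhoC r (Φ.flow s z) x) (thetaC r (Φ.flow s z) x) *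
        (deriv (fun s' => φ s' x) s + ∑ k, momC r (Φ.flow s z) x k / rhoC r (Φ.flow s z) x * pD k (φ s) x))
      + (∫ x, φ s x / thetaC r (Φ.flow s z) x * ∑ k, ∑ l, devC r (Φ.flow s z) x k l * pD k (fun y => uC r (Φ.flow s z) y l) x)
      - (∫ x, φ s x / thetaC r (Φ.flow s z) x * pexC σ r (Φ.flow s z) x * ∑ k, pD k (fun y => uC r (Φ.flow s z) y k) x)
      - ∫ x, ∑ k, pD k (fun y => φ s y / thetaC r (Φ.flow s z) y) x * qkinC r (Φ.flow s z) x k := by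
  have hreg := hR.2 s hs
  have hφs : Torus.IsSmooth (φ s) := hφ.isSmooth_slice (Set.mem_univ s)
  have hG := integral_mul_dSfl hE hη₁ hσ hr hc (Φ.flow s z) hreg (g := φ s) (hφs.isContDiff (by simp))
  rw [obsD_orbit_eq hE hη hη₁ hσ hr hc hφ Φ hR hs, hG.2]
  have hSc := continuous_Hs_comp hE hη₁ hσ hr hc (Φ.flow s z) hreg
  have hdφ : Continuous fun x => deriv (fun s' => φ s' x) s := (continuous_uncurry_deriv_of_smooth hφ).uncurry_left s
  have hB : Continuous fun x => ∑ k, momC r (Φ.flow s z) x k / rhoC r (Φ.flow s z) x * pD k (φ s) x :=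
    continuous_finsetSum _ fun k _ => ((continuous_momC_apply hr _ k).div (continuous_rhoC hr _) fun x =>
      (hc.trans_le (hreg x).1).ne').mul (hφs.partialDeriv k).continuous
  have hI1 : Integrable fun x => Hs σ (rhoC r (Φ.flow s z) x) (thetaC r (Φ.flow s z) x) * deriv (fun s' => φ s' x) s :=
    integrable_of_continuous_T3 (hSc.mul hdφ)
  have hI2 : Integrable fun x => Hs σ (rhoC r (Φ.flow s z) x) (thetaC r (Φ.flow s z) x) *
      ∑ k, momC r (Φ.flow s z) x k / rhoC r (Φ.flow s z) x * pD k (φ s) x := integrable_of_continuous_T3 (hSc.mul hB)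
  have hE' : (∫ x, Hs σ (rhoC r (Φ.flow s z) x) (thetaC r (Φ.flow s z) x) *
        (deriv (fun s' => φ s' x) s + ∑ k, momC r (Φ.flow s z) x k / rhoC r (Φ.flow s z) x * pD k (φ s) x)) =
      (∫ x, Hs σ (rhoC r (Φ.flow s z) x) (thetaC r (Φ.flow s z) x) * deriv (fun s' => φ s' x) s)
        + ∫ x, Hs σ (rhoC r (Φ.flow s z) x) (thetaC r (Φ.flow s z) x) *
          ∑ k, momC r (Φ.flow s z) x k / rhoC r (Φ.flow s z) x * pD k (φ s) x := by
    rw [← integral_add hI1 hI2]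
    exact integral_congr_ae (Filter.Eventually.of_forall fun x => by simp only [mul_add])
  rw [hE']
  ring

include hE hη hη₁ hσ hr hc hτ hφ hsupp hR in
/-- **The weak balance law on the regular orbit**: `-bdry = ∫₀^τ F'(s, Φₛz) ds + Σ_{collisions ∈ (0,τ]} jumps`
(the Literature's `sub_eq_integral_add_finsum_collisionJump_td` for the observable `∫ Ĥ(U_r) φ(s,·)`, with
`F(τ) = 0` by the support of `φ` and `F(0) = bdry` on the regular range). [folklore] -/
theorem balance_orbit :
    -bdry σ r (φ 0) Φ z = (∫ s in Set.Icc 0 τ, obsD σ c η₀ η₁ r φ s (Φ.flow s z))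
      + ∑ᶠ t ∈ collisionTimes (Torus.geometry (Fin 3)) (hsDiameter σ N) (fun t => Φ.flow t z) ∩ Set.Ioc 0 τ,
          collisionJump (obs σ c η₀ η₁ r φ t) (fun t => Φ.flow t z) t := by
  have htraj := Φ.isTrajectory z hR.1
  have key := (htraj.sub_eq_integral_add_finsum_collisionJump_td (F := obs σ c η₀ η₁ r φ) (F' := obsD σ c η₀ η₁ r φ)
    hG3 (hasDerivAt_obs_freeFlight hE hη hη₁ hσ hc hr hφ) (continuous_obsD_freeFlight hE hη hη₁ hσ hc hr hφ) hτ.le).2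
  obtain ⟨τ', hτ', hzero⟩ := hsupp
  have hτ0 : obs σ c η₀ η₁ r φ τ (Φ.flow τ z) = 0 := by
    unfold obs
    simp [hzero τ hτ'.le]
  have h00 : obs σ c η₀ η₁ r φ 0 (Φ.flow 0 z) = bdry σ r (φ 0) Φ z := by
    rw [obs_eq hη₁ hc (hR.2 0 ⟨le_rfl, hτ.le⟩)]
    rfl
  rw [hτ0, h00, zero_sub, intervalIntegral.integral_of_le hτ.le, ← integral_Icc_eq_integral_Ioc] at key
  exact key

include hE hη hη₁ hσ hr hc hφ hR in
/-- **The time integral of the streaming derivative on the regular orbit** is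
`entropyFunctional - T₁ - T₂smooth - T₃kin`. [folklore] -/
theorem integral_obsD_orbit :
    ∫ s in Set.Icc 0 τ, obsD σ c η₀ η₁ r φ s (Φ.flow s z) =
      entropyFunctional σ r τ φ Φ z - T₁ σ r τ φ Φ z - T₂smooth σ r τ φ Φ z - T₃kin σ r τ φ Φ z := by
  have hIE := integrableOn_innerE hE hη hη₁ hσ hr hc hφ Φ hR
  have hI1 := integrableOn_innerT₁ hr hc hφ Φ hR
  have hI2 := integrableOn_innerT₂ hE hη hη₁ hσ hr hc hφ Φ hR
  have hI3 := integrableOn_innerT₃ hr hc hφ Φ hR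
  have hcongr := setIntegral_congr_fun (μ := (volume : Measure ℝ)) measurableSet_Icc
    (fun s hs => obsD_orbit_eq_ledger hE hη hη₁ hσ hr hc hφ Φ hR hs)
  have hA : IntegrableOn (fun s => (∫ x, Hs σ (rhoC r (Φ.flow s z) x) (thetaC r (Φ.flow s z) x) *
        (deriv (fun s' => φ s' x) s + ∑ k, momC r (Φ.flow s z) x k / rhoC r (Φ.flow s z) x * pD k (φ s) x))
      + (∫ x, φ s x / thetaC r (Φ.flow s z) x * ∑ k, ∑ l, devC r (Φ.flow s z) x k l * pD k (fun y => uC r (Φ.flow s z) y l) x))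
      (Set.Icc 0 τ) := hIE.add hI1
  have hB : IntegrableOn (fun s => (∫ x, Hs σ (rhoC r (Φ.flow s z) x) (thetaC r (Φ.flow s z) x) *
        (deriv (fun s' => φ s' x) s + ∑ k, momC r (Φ.flow s z) x k / rhoC r (Φ.flow s z) x * pD k (φ s) x))
      + (∫ x, φ s x / thetaC r (Φ.flow s z) x * ∑ k, ∑ l, devC r (Φ.flow s z) x k l * pD k (fun y => uC r (Φ.flow s z) y l) x)
      - (∫ x, φ s x / thetaC r (Φ.flow s z) x * pexC σ r (Φ.flow s z) x * ∑ k, pD k (fun y => uC r (Φ.flow s z) y k) x))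
      (Set.Icc 0 τ) := hA.sub hI2
  rw [hcongr, integral_sub hB hI3, integral_sub hA hI2, integral_add hIE hI1]
  have hT1 : T₁ σ r τ φ Φ z = -∫ s in Set.Icc 0 τ, ∫ x, φ s x / thetaC r (Φ.flow s z) x *
      ∑ k, ∑ l, devC r (Φ.flow s z) x k l * pD k (fun y => uC r (Φ.flow s z) y l) x := rfl
  have hT2 : T₂smooth σ r τ φ Φ z = ∫ s in Set.Icc 0 τ, ∫ x, φ s x / thetaC r (Φ.flow s z) x * pexC σ r (Φ.flow s z) x *
      ∑ k, pD k (fun y => uC r (Φ.flow s z) y k) x := rfl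
  have hT3 : T₃kin σ r τ φ Φ z = ∫ s in Set.Icc 0 τ, ∫ x, ∑ k, pD k (fun y => φ s y / thetaC r (Φ.flow s z) y) x *
      qkinC r (Φ.flow s z) x k := rfl
  have hEF : entropyFunctional σ r τ φ Φ z = ∫ s in Set.Icc 0 τ, ∫ x, Hs σ (rhoC r (Φ.flow s z) x) (thetaC r (Φ.flow s z) x) *
      (deriv (fun s' => φ s' x) s + ∑ k, momC r (Φ.flow s z) x k / rhoC r (Φ.flow s z) x * pD k (φ s) x) := rfl
  rw [hT1, hT2, hT3, hEF]
  ring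

end Balance

end L

/-- **Registered sub-goal `ledgerL_orbit`** of stub `stub_ledger` (line `exact-entropy-ledger-three-passivities`):
The time integral of the streaming derivative on the regular orbit is the crux functional minus the smooth ledger terms. [folklore] -/
theorem ledgerL_orbit :
  ∀ {N : ℕ} {σ r c η₁ η₀ τ : ℝ} {F : ℝ → ℝ}, EosBand η₀ F → 0 < η₁ → η₁ < η₀ → 0 < σ → 0 < r → 0 < c → ∀ {φ : ℝ → T3 → ℝ}, Literature.Analysis.FunctionSpaces.Torus.IsSmoothSpaceTimeOn Set.univ φ → ∀ (Φ : Flow σ N) {z : Phase N}, Regular σ r τ c η₁ Φ z → ∫ s in Set.Icc 0 τ, L.obsD σ c η₀ η₁ r φ s (Φ.flow s z) = entropyFunctional σ r τ φ Φ z - T₁ σ r τ φ Φ z - T₂smooth σ r τ φ Φ z - T₃kin σ r τ φ Φ z := by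
  intro N σ r c η₁ η₀ τ F hE hη hη₁ hσ hr hc φ hφ Φ z hR
  exact L.integral_obsD_orbit hE hη hη₁ hσ hr hc hφ Φ hR

end Summit.AtomisticToContinuum.HydrodynamicLimit.Theorems.LocalSecondLawLedger

end
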